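import Literature.NumberTheory.Sieve.BombieriVinogradovMoebius
import Literature.NumberTheory.Sieve.RoughNumbersCoprimeProgressions
import HarnessLib

/-!
# Route `LeeYangFibres`, crux `RelativeDimOne` (stmt-Parity-14113), line `single-moebius-split`:
# helper file 1 for the stub `stub_moebiusTermBV` — arithmetic toolkit

Elementary counting lemmas used by the proof of `MoebiusTermBound k` (the pure-Möbius term of
the telescoping is `o(N)`):

* `affCongr_singleClass` — **a system of affine congruences cuts out one residue class**: for
  moduli `n_i ≥ 1` and integers `α_i ≠ 0`, `β_i`, the set `{x ∈ ℤ : n_i ∣ α_i x + β_i ∀ i}` is empty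
  or a single class modulo `M = lcm_i (n_i / gcd(n_i, |α_i|))`; `M ∣ ∏ n_i` and each `n_i` factors
  as `g · m` with `g ∣ |α_i|`, `m ∣ M` (used to count the tuples with a given `M`);
* `card_fiber_le` — the resulting fibre count `#{t : M(t) = Q} ≤ ∏_i τ(A_i) τ(Q)`;
* `sum_pow_card_divisors_div_le` — `∑_{n ≤ K} τ(n)^m / n ≤ (1 + log K)^{2^m}`
  (`τ(n)^{m+1} ≤ ∑_{ab = n} τ(a)^m τ(b)^m` and Dirichlet's hyperbola, as the tree's
  `BVMoebius.sum_card_divisors_cube_div_le`);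
* `sum_mul_le_sqrt_mul_sqrt` — Cauchy–Schwarz `∑ c_q G_q ≤ (∑ c_q² G_q)^{1/2} (∑ G_q)^{1/2}`
  for `G ≥ 0`;
* `abs_card_filter_modEq_dvd_sub_le` — the members of a class `r (mod Q)` in `(V₁, V₂]` that are
  divisible by `d` number `[gcd(Q,d) ∣ r] (V₂ − V₁) gcd(Q,d)/(Qd) + O(1)` (Chinese remainder theorem
  and the tree's `BFI.abs_card_Ioc_filter_modEq_sub_le`).

References: D. A. Goldston, C. Y. Yıldırım, *Higher correlations of divisor sums related to primes
I*, Integers 3 (2003) A5 [GoldstonYildirim2001]; H. Iwaniec, E. Kowalski, *Analytic Number Theory*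
(2004), §1.5 and Thm. 17.1 [IwaniecKowalski2004].
-/

noncomputable section

open Finset

namespace Summit.Parity.GeneralizedHardyLittlewood.Cruxes.RelativeDimOne.SingleMoebiusSplit

/-! ### Affine congruences -/

/-- **A system of affine congruences cuts out one residue class.** For moduli `n_i ≥ 1` and
integers `α_i ≠ 0`, `β_i` there is `M ≥ 1` (namely `lcm_i (n_i / gcd(n_i, |α_i|))`) with `M ∣ ∏ n_i`,
each `n_i = g m` for some `g ∣ |α_i|`, `m ∣ M`, and such that whenever `x` solves
`n_i ∣ α_i x + β_i` for all `i`, an integer `y` solves the system iff `M ∣ y − x`. [folklore] -/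
theorem affCongr_singleClass : ∀ (k : ℕ) (α β : Fin k → ℤ) (n : Fin k → ℕ), (∀ i, α i ≠ 0) → (∀ i, 0 < n i) → ∃ M : ℕ, 0 < M ∧ M ∣ ∏ i, n i ∧ (∀ i, ∃ g m : ℕ, g ∣ (α i).natAbs ∧ m ∣ M ∧ n i = g * m) ∧ ∀ x y : ℤ, (∀ i, (n i : ℤ) ∣ α i * x + β i) → ((∀ i, (n i : ℤ) ∣ α i * y + β i) ↔ (M : ℤ) ∣ y - x) := by
  intro k α β n _hα hn
  classical
  -- reduced moduli `n' i = n i / gcd(n i, |α i|)`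
  set g : Fin k → ℕ := fun i => Nat.gcd (n i) (α i).natAbs with hg
  set n' : Fin k → ℕ := fun i => n i / g i with hn'
  set a' : Fin k → ℕ := fun i => (α i).natAbs / g i with ha'
  have hg0 : ∀ i, 0 < g i := fun i => Nat.gcd_pos_of_pos_left _ (hn i)
  have hgn : ∀ i, g i ∣ n i := fun i => Nat.gcd_dvd_left _ _
  have hga : ∀ i, g i ∣ (α i).natAbs := fun i => Nat.gcd_dvd_right _ _
  have hgα : ∀ i, (g i : ℤ) ∣ α i := fun i => Int.natCast_dvd.2 (hga i)
  have hnn' : ∀ i, n i = g i * n' i := fun i => (Nat.mul_div_cancel' (hgn i)).symm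
  have haa' : ∀ i, (α i).natAbs = g i * a' i := fun i => (Nat.mul_div_cancel' (hga i)).symm
  have hn'0 : ∀ i, 0 < n' i := fun i => Nat.div_pos (Nat.le_of_dvd (hn i) (hgn i)) (hg0 i)
  have hcop : ∀ i, Nat.Coprime (n' i) (a' i) := fun i => Nat.coprime_div_gcd_div_gcd (hg0 i)
  set M : ℕ := Finset.univ.lcm n' with hM
  have hn'M : ∀ i, n' i ∣ M := fun i => Finset.dvd_lcm (Finset.mem_univ i)
  have hM0 : 0 < M := by
    refine Nat.pos_of_ne_zero fun h => ?_
    obtain ⟨i, -, hi⟩ := (Finset.lcm_eq_zero_iff).1 h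
    exact (hn'0 i).ne' hi
  refine ⟨M, hM0, ?_, ?_, ?_⟩
  · -- `M ∣ ∏ n_i`
    refine Finset.lcm_dvd fun i _ => ?_
    exact dvd_trans (Nat.div_dvd_of_dvd (hgn i)) (Finset.dvd_prod_of_mem n (Finset.mem_univ i))
  · -- the factorisation `n i = g · n' i`
    intro i
    exact ⟨g i, n' i, hga i, hn'M i, hnn' i⟩
  · intro x y hx
    constructor
    · -- two solutions differ by a multiple of `M`
      intro hy
      have hdiv : ∀ i, n' i ∣ (y - x).natAbs := by
        intro i
        have h1 : (n i : ℤ) ∣ α i * (y - x) := by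
          have := dvd_sub (hy i) (hx i)
          rwa [show α i * y + β i - (α i * x + β i) = α i * (y - x) by ring] at this
        have h2 : n i ∣ (α i).natAbs * (y - x).natAbs := by
          rw [← Int.natAbs_mul]
          exact Int.natCast_dvd.1 h1
        rw [hnn' i, haa' i, mul_assoc] at h2
        exact (hcop i).dvd_of_dvd_mul_left ((Nat.mul_dvd_mul_iff_left (hg0 i)).1 h2)
      exact Int.natCast_dvd.2 (Finset.lcm_dvd fun i _ => hdiv i)
    · -- a translate of a solution by a multiple of `M` is a solution
      intro hM' i
      have h1 : (n' i : ℤ) ∣ y - x := dvd_trans (Int.natCast_dvd_natCast.2 (hn'M i)) hM'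
      have h2 : (n i : ℤ) ∣ α i * (y - x) := by
        rw [hnn' i, Nat.cast_mul]
        exact mul_dvd_mul (hgα i) h1
      have h3 := dvd_add (hx i) h2
      rwa [show α i * x + β i + α i * (y - x) = α i * y + β i by ring] at h3

/-- **The fibre count.** If every `t` in the fibre `{t ∈ S : F t = Q}` has coordinates
`t i = g m` with `g ∣ A_i` and `m ∣ Q` (`A_i, Q ≠ 0`), the fibre has at most `∏_i τ(A_i) τ(Q)`
elements. [folklore] -/
theorem card_fiber_le {k : ℕ} (S : Finset (Fin k → ℕ)) {A : Fin k → ℕ} (hA : ∀ i, A i ≠ 0)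
    (F : (Fin k → ℕ) → ℕ) {Q : ℕ} (hQ : Q ≠ 0)
    (h : ∀ t ∈ S, F t = Q → ∀ i, ∃ g m : ℕ, g ∣ A i ∧ m ∣ Q ∧ t i = g * m) :
    #(S.filter (fun t => F t = Q)) ≤ ∏ i, (#(A i).divisors * #Q.divisors) := by
  classical
  calc #(S.filter (fun t => F t = Q))
      ≤ #(Fintype.piFinset fun i => ((A i).divisors ×ˢ Q.divisors).image (fun p => p.1 * p.2)) := by
        refine Finset.card_le_card fun t ht => ?_
        rw [Finset.mem_filter] at ht
        refine Fintype.mem_piFinset.2 fun i => ?_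
        obtain ⟨g, m, hg, hm, hti⟩ := h t ht.1 ht.2 i
        exact Finset.mem_image.2 ⟨(g, m), Finset.mem_product.2
          ⟨Nat.mem_divisors.2 ⟨hg, hA i⟩, Nat.mem_divisors.2 ⟨hm, hQ⟩⟩, hti.symm⟩
    _ = ∏ i, #(((A i).divisors ×ˢ Q.divisors).image (fun p => p.1 * p.2)) :=
        Fintype.card_piFinset _
    _ ≤ ∏ i, (#(A i).divisors * #Q.divisors) :=
        Finset.prod_le_prod' fun i _ => Finset.card_image_le.trans (Finset.card_product _ _).le

/-! ### Divisor sums -/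

/-- `τ(n)^{m+1} ≤ ∑_{ab = n} τ(a)^m τ(b)^m` (`τ(n) ≤ τ(a)τ(b)` for each factorisation).
[folklore] -/
theorem pow_succ_card_divisors_le (m n : ℕ) :
    (#n.divisors : ℝ) ^ (m + 1) ≤
      ∑ y ∈ n.divisorsAntidiagonal, (#y.1.divisors : ℝ) ^ m * (#y.2.divisors : ℝ) ^ m := by
  -- adapted from `Literature.NumberTheory.Sieve.BVMoebius.card_divisors_pow_three_le`
  have hcard : (#n.divisorsAntidiagonal : ℝ) = (#n.divisors : ℝ) := by
    rw [Literature.NumberTheory.Sieve.Vaughan.card_divisors_eq_sum_antidiagonal n, sum_const,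
      nsmul_eq_mul, mul_one]
  calc (#n.divisors : ℝ) ^ (m + 1) = (#n.divisorsAntidiagonal : ℝ) * (#n.divisors : ℝ) ^ m := by
        rw [hcard]; ring
    _ = ∑ _y ∈ n.divisorsAntidiagonal, (#n.divisors : ℝ) ^ m := by rw [sum_const, nsmul_eq_mul]
    _ ≤ _ := sum_le_sum fun y hy => by
        have hn : y.1 * y.2 = n := (Nat.mem_divisorsAntidiagonal.1 hy).1
        have h := Literature.NumberTheory.Sieve.Vaughan.card_divisors_mul_le y.1 y.2
        rw [hn] at h
        have h' : (#n.divisors : ℝ) ≤ (#y.1.divisors : ℝ) * (#y.2.divisors : ℝ) := by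
          exact_mod_cast h
        calc (#n.divisors : ℝ) ^ m ≤ ((#y.1.divisors : ℝ) * (#y.2.divisors : ℝ)) ^ m :=
              pow_le_pow_left₀ (Nat.cast_nonneg _) h' m
          _ = _ := by ring

/-- `∑_{n ≤ K} 1/n ≤ 1 + log K`. [folklore] -/
theorem sum_Ioc_inv_le (K : ℕ) : ∑ n ∈ Ioc 0 K, (1 : ℝ) / n ≤ 1 + Real.log K := by
  have h := harmonic_le_one_add_log K
  rw [harmonic_eq_sum_Icc, Rat.cast_sum] at h
  rw [← Finset.Icc_add_one_left_eq_Ioc, zero_add]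
  refine le_trans (le_of_eq (Finset.sum_congr rfl fun n _ => ?_)) h
  rw [Rat.cast_inv, Rat.cast_natCast, one_div]

/-- `∑_{n ≤ K} τ(n)^m / n ≤ (1 + log K)^{2^m}` (induction on `m`: the hyperbola method gives
`S_{m+1} ≤ S_m²`). [folklore] -/
theorem sum_pow_card_divisors_div_le : ∀ (m K : ℕ), ∑ n ∈ Ioc 0 K, (#n.divisors : ℝ) ^ m / n ≤ (1 + Real.log K) ^ (2 ^ m) := by
  -- adapted from `Literature.NumberTheory.Sieve.BVMoebius.sum_card_divisors_cube_div_le`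
  intro m
  induction m with
  | zero =>
      intro K
      simpa only [pow_zero, pow_one] using sum_Ioc_inv_le K
  | succ m ih =>
      intro K
      have hlog : 0 ≤ 1 + Real.log K := by
        have := Real.log_natCast_nonneg K
        linarith
      have hS : 0 ≤ (1 + Real.log K) ^ (2 ^ m) := pow_nonneg hlog _
      calc ∑ n ∈ Ioc 0 K, (#n.divisors : ℝ) ^ (m + 1) / n
          ≤ ∑ n ∈ Ioc 0 K, ∑ y ∈ n.divisorsAntidiagonal,
              ((#y.1.divisors : ℝ) ^ m / y.1) * ((#y.2.divisors : ℝ) ^ m / y.2) := by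
            refine sum_le_sum fun n hn => ?_
            have hn0 : (0 : ℝ) < n := by exact_mod_cast (mem_Ioc.1 hn).1
            rw [div_le_iff₀ hn0, sum_mul]
            refine (pow_succ_card_divisors_le m n).trans (le_of_eq (sum_congr rfl fun y hy => ?_))
            have hyn := (Nat.mem_divisorsAntidiagonal.1 hy).1
            have hy1 : (y.1 : ℝ) ≠ 0 := by
              have : y.1 ≠ 0 := left_ne_zero_of_mul (hyn.symm ▸ (Nat.mem_divisorsAntidiagonal.1 hy).2)
              exact_mod_cast this
            have hy2 : (y.2 : ℝ) ≠ 0 := by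
              have : y.2 ≠ 0 := right_ne_zero_of_mul (hyn.symm ▸ (Nat.mem_divisorsAntidiagonal.1 hy).2)
              exact_mod_cast this
            have hn' : (n : ℝ) = (y.1 : ℝ) * y.2 := by exact_mod_cast hyn.symm
            rw [hn']; field_simp
        _ = ∑ d ∈ Ioc 0 K, ∑ e ∈ Ioc 0 (K / d),
              ((#d.divisors : ℝ) ^ m / d) * ((#e.divisors : ℝ) ^ m / e) :=
            Literature.NumberTheory.Sieve.Vaughan.sum_Ioc_sum_divisorsAntidiagonal_eq
              (fun d e => ((#d.divisors : ℝ) ^ m / d) * ((#e.divisors : ℝ) ^ m / e)) K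
        _ ≤ ∑ d ∈ Ioc 0 K, ((#d.divisors : ℝ) ^ m / d) * (1 + Real.log K) ^ (2 ^ m) := by
            refine sum_le_sum fun d _ => ?_
            rw [← mul_sum]
            refine mul_le_mul_of_nonneg_left (le_trans ?_ (ih K)) (by positivity)
            exact sum_le_sum_of_subset_of_nonneg (Ioc_subset_Ioc_right (Nat.div_le_self K d))
              fun _ _ _ => by positivity
        _ = (∑ d ∈ Ioc 0 K, (#d.divisors : ℝ) ^ m / d) * (1 + Real.log K) ^ (2 ^ m) := by
            rw [sum_mul]
        _ ≤ (1 + Real.log K) ^ (2 ^ m) * (1 + Real.log K) ^ (2 ^ m) :=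
            mul_le_mul_of_nonneg_right (ih K) hS
        _ = (1 + Real.log K) ^ (2 ^ (m + 1)) := by rw [← pow_add]; ring_nf

/-! ### Cauchy–Schwarz -/

/-- Cauchy–Schwarz in the form `∑ c_q G_q ≤ (∑ c_q² G_q)^{1/2} (∑ G_q)^{1/2}` for `G ≥ 0`.
[folklore] -/
theorem sum_mul_le_sqrt_mul_sqrt {ι : Type*} (s : Finset ι) (c G : ι → ℝ) (hG : ∀ q ∈ s, 0 ≤ G q) :
    ∑ q ∈ s, c q * G q ≤ Real.sqrt (∑ q ∈ s, c q ^ 2 * G q) * Real.sqrt (∑ q ∈ s, G q) := by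
  have hfg : ∑ q ∈ s, c q * G q = ∑ q ∈ s, (c q * Real.sqrt (G q)) * Real.sqrt (G q) := by
    refine sum_congr rfl fun q hq => ?_
    rw [mul_assoc, Real.mul_self_sqrt (hG q hq)]
  have hf2 : ∑ q ∈ s, (c q * Real.sqrt (G q)) ^ 2 = ∑ q ∈ s, c q ^ 2 * G q := by
    refine sum_congr rfl fun q hq => ?_
    rw [mul_pow, Real.sq_sqrt (hG q hq)]
  have hg2 : ∑ q ∈ s, Real.sqrt (G q) ^ 2 = ∑ q ∈ s, G q :=
    sum_congr rfl fun q hq => Real.sq_sqrt (hG q hq)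
  have hcs := Finset.sum_mul_sq_le_sq_mul_sq s (fun q => c q * Real.sqrt (G q))
    (fun q => Real.sqrt (G q))
  rw [← hfg, hf2, hg2] at hcs
  have h1 : 0 ≤ ∑ q ∈ s, c q ^ 2 * G q := sum_nonneg fun q hq => by
    have := hG q hq; positivity
  calc ∑ q ∈ s, c q * G q ≤ |∑ q ∈ s, c q * G q| := le_abs_self _
    _ = Real.sqrt ((∑ q ∈ s, c q * G q) ^ 2) := (Real.sqrt_sq_eq_abs _).symm
    _ ≤ Real.sqrt ((∑ q ∈ s, c q ^ 2 * G q) * ∑ q ∈ s, G q) := Real.sqrt_le_sqrt hcs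
    _ = _ := Real.sqrt_mul h1 _

/-! ### A residue class and a divisibility condition in an interval -/

/-- **The class `r (mod Q)` in `(V₁, V₂]`, restricted to the multiples of `d`.** By the Chinese
remainder theorem the conditions `v ≡ r (mod Q)`, `d ∣ v` are incompatible unless `gcd(Q, d) ∣ r`,
and then cut out one class modulo `lcm(Q, d) = Qd/gcd(Q, d)`; so the count is
`[gcd(Q,d) ∣ r] (V₂ − V₁) gcd(Q,d)/(Qd)` up to an error of at most `1`. [folklore] -/
theorem abs_card_filter_modEq_dvd_sub_le : ∀ (Q d : ℕ), 0 < Q → 0 < d → ∀ (r : ℤ) (V₁ V₂ : ℕ), V₁ ≤ V₂ → |(#((Ioc V₁ V₂).filter (fun v : ℕ => (v : ℤ) ≡ r [ZMOD Q] ∧ d ∣ v)) : ℝ) - (if ((Nat.gcd Q d : ℕ) : ℤ) ∣ r then ((V₂ : ℝ) - V₁) * (Nat.gcd Q d) / ((Q : ℝ) * d) else 0)| ≤ 1 := by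
  intro Q d hQ hd r V₁ V₂ hV
  set g : ℕ := Nat.gcd Q d with hgdef
  have hg0 : 0 < g := Nat.gcd_pos_of_pos_left _ hQ
  by_cases hgr : ((g : ℕ) : ℤ) ∣ r
  · -- a particular solution `x₀ ≡ r (mod Q)`, `d ∣ x₀`, from Bézout
    rw [if_pos hgr]
    obtain ⟨r', hr'⟩ := hgr
    set x₀ : ℤ := (d : ℤ) * Nat.gcdB Q d * r' with hx₀
    have hbez : ((g : ℕ) : ℤ) = Q * Nat.gcdA Q d + d * Nat.gcdB Q d := Nat.gcd_eq_gcd_ab Q d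
    have hx₀r : x₀ ≡ r [ZMOD Q] := by
      refine Int.modEq_iff_dvd.2 ⟨Nat.gcdA Q d * r', ?_⟩
      rw [hr', hbez, hx₀]; ring
    have hx₀d : (d : ℤ) ∣ x₀ := ⟨Nat.gcdB Q d * r', by rw [hx₀]; ring⟩
    -- the two conditions are one congruence modulo `lcm(Q, d)`
    set Lc : ℕ := Nat.lcm Q d with hLc
    have hLc0 : 0 < Lc := Nat.pos_of_ne_zero (Nat.lcm_ne_zero hQ.ne' hd.ne')
    have hiff : ∀ v : ℕ, ((v : ℤ) ≡ r [ZMOD Q] ∧ d ∣ v) ↔ (v : ℤ) ≡ x₀ [ZMOD Lc] := by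
      intro v
      have e : ((Q : ℤ).lcm (d : ℤ) : ℤ) = (Lc : ℤ) := by rw [hLc]; rfl
      rw [← e, ← Int.modEq_and_modEq_iff_modEq_lcm]
      constructor
      · rintro ⟨h1, h2⟩
        refine ⟨h1.trans hx₀r.symm, ?_⟩
        have h2' : (d : ℤ) ∣ (v : ℤ) := Int.natCast_dvd_natCast.2 h2
        exact Int.modEq_iff_dvd.2 (dvd_sub hx₀d h2')
      · rintro ⟨h1, h2⟩
        refine ⟨h1.trans hx₀r, ?_⟩
        have h3 : (d : ℤ) ∣ x₀ - v := Int.modEq_iff_dvd.1 h2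
        have : (d : ℤ) ∣ (v : ℤ) := by
          have := dvd_sub hx₀d h3
          rwa [sub_sub_cancel] at this
        exact Int.natCast_dvd_natCast.1 this
    -- reduce the residue to `[0, Lc)`
    set c : ℕ := (x₀ % Lc).toNat with hc
    have hLc' : (0 : ℤ) < Lc := by exact_mod_cast hLc0
    have hc0 : 0 ≤ x₀ % Lc := Int.emod_nonneg _ hLc'.ne'
    have hceq : ((c : ℕ) : ℤ) = x₀ % Lc := Int.toNat_of_nonneg hc0
    have hclt : c < Lc := by
      have h1 := Int.emod_lt_of_pos x₀ hLc'
      rw [← hceq] at h1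
      exact_mod_cast h1
    have hfilt : (Ioc V₁ V₂).filter (fun v : ℕ => (v : ℤ) ≡ r [ZMOD Q] ∧ d ∣ v) =
        (Ioc V₁ V₂).filter (fun v : ℕ => v ≡ c [MOD Lc]) := by
      refine Finset.filter_congr fun v _ => ?_
      rw [hiff v, Nat.ModEq, Nat.mod_eq_of_lt hclt]
      have e : ((v : ℤ) ≡ x₀ [ZMOD (Lc : ℤ)]) ↔ ((v % Lc : ℕ) : ℤ) = ((c : ℕ) : ℤ) := by
        rw [hceq, Int.natCast_mod]
        rfl
      rw [e]
      exact Int.natCast_inj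
    rw [hfilt]
    have h := Literature.NumberTheory.Sieve.BFI.abs_card_Ioc_filter_modEq_sub_le hLc0 c hV
    have hLcg : ((V₂ : ℝ) - V₁) * g / ((Q : ℝ) * d) = ((V₂ : ℝ) - V₁) / Lc := by
      have hgl : (g : ℝ) * Lc = (Q : ℝ) * d := by
        rw [hgdef, hLc]; exact_mod_cast Nat.gcd_mul_lcm Q d
      have hg0' : (0 : ℝ) < g := by exact_mod_cast hg0
      have hLc0' : (0 : ℝ) < Lc := by exact_mod_cast hLc0
      rw [← hgl]
      field_simp
    rw [hLcg]
    exact h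
  · -- no solutions
    rw [if_neg hgr]
    have hempty : (Ioc V₁ V₂).filter (fun v : ℕ => (v : ℤ) ≡ r [ZMOD Q] ∧ d ∣ v) = ∅ := by
      refine Finset.filter_eq_empty_iff.2 fun v _ h => hgr ?_
      obtain ⟨h1, h2⟩ := h
      have hgQ : ((g : ℕ) : ℤ) ∣ (Q : ℤ) := Int.natCast_dvd_natCast.2 (Nat.gcd_dvd_left Q d)
      have hgd : ((g : ℕ) : ℤ) ∣ (v : ℤ) :=
        Int.natCast_dvd_natCast.2 (dvd_trans (Nat.gcd_dvd_right Q d) h2)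
      have h3 : (Q : ℤ) ∣ r - v := Int.modEq_iff_dvd.1 h1
      have h4 : ((g : ℕ) : ℤ) ∣ r - v := dvd_trans hgQ h3
      have := dvd_add h4 hgd
      rwa [sub_add_cancel] at this
    rw [hempty, Finset.card_empty, Nat.cast_zero, sub_zero, abs_zero]
    exact zero_le_one

end Summit.Parity.GeneralizedHardyLittlewood.Cruxes.RelativeDimOne.SingleMoebiusSplit
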